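import Summits.HodgeConjecture.CorCM.Census.CentralSquaresDihedralFactor

/-!
# The square-central class, X: THE DIHEDRAL QUOTIENT LAW — `μ(G, c) = φ₂(G, c)` for a `2`-group mapping onto `D₄` with `c ↦ r²` and `s` lifting to an involution

COR-CM (cell `pub-hodgecm2`), count-neutral kernel combinatorics by the binder seat b09 (gen 45; lane SQUARE-CENTRAL CLASS, part X), part VIIIʼs four-type
law (`isLeast_card_gfaces_generate_four`) BY NAME along a surjection onto the dihedral group of order `8`; the eight-element facts about `D₄` are part IXʼs
(`dihedral_isCMF`, `dihedral_base`, `dihedral_H`, `dihedral_Hc`, `dihedral_sigma_H`, `dihedral_sigma_val`).  Theorems only: no definition, no certificate, no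
named fact, no `sorry`.  HONEST FRAMING: `HC_CM` is NOT proved, here or anywhere in the tree; nothing here is a period or a headline.

**THE DIHEDRAL QUOTIENT LAW (`isLeast_card_gfaces_generate_of_dihedral_quotient`).**  Let `G` be a finite `2`-group with a central involution `c`, and let
`π : G →* D₄` be a SURJECTIVE homomorphism with `π c = r²` whose kernel has at least `4` elements, such that the reflection `s` lifts to an involution
`q ∈ G` (`π q = s`, `q² = 1`).  Then **`μ(G, c) = φ₂(G, c)`**.  Instances: `G = D₄ × E` (part IX: `π` the first projection), every semidirect product
`N ⋊ D₄` of a `2`-group `N` of order `≥ 4` on which `r²` acts trivially (`c = r²`, `q = s`), and non-split extensions in which `s` still lifts to an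
involution.  The datum: `T₀ = π⁻¹{1, r, s, sr}`, the swap `q`, `T₁ = T₀·q⁻¹ = π⁻¹{1, r³, s, sr³}`, `𝓗 = π⁻¹{r, sr}`, transversals `π⁻¹(r)` and `ker π`,
`m = |ker π|`.

## References
* [Pohlmann1968] H. Pohlmann, Algebraic cycles on abelian varieties of complex multiplication type, Ann. of Math. 88 (1968), Thm 1.
* [Milne1999] J. S. Milne, Lefschetz motives and the Tate conjecture, Compositio Math. 117 (1999), Prop. 2.1, p. 54.
-/

namespace Summit.HodgeConjecture.CorCM.Census.CentralSquares

open Finset DihedralGroup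
open Summit.HodgeConjecture.CorCM.Prior.AllgGroup.RfwfAllgGroup
open Summit.HodgeConjecture.CorCM.Census.BlockParity
open Summit.HodgeConjecture.CorCM.Census.Coinvariant
open Summit.HodgeConjecture.CorCM.Census.TwistGeneration
open Summit.HodgeConjecture.CorCM.Census.BaseBlock

noncomputable section

variable {G : Type*} [Group G] [Fintype G] [DecidableEq G]

omit [DecidableEq G] in
/-- **The pull-back of `X₀ = {1, r, s, sr}` along `π` is a CM type** when `π c = r²`. [folklore] -/
theorem isCMF_comap {c : G} (π : G →* DihedralGroup 4) (hπc : π c = r 2) :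
    IsCMF c (univ.filter fun g : G => π g ∈ ({r 0, r 1, sr 0, sr 1} : Finset (DihedralGroup 4))) := by
  intro x
  simp only [mem_filter, mem_univ, true_and, map_mul, hπc]
  exact dihedral_isCMF (π x)

/-- **A fibre of a surjective homomorphism to `D₄` has `|ker π|` elements**: `|π⁻¹(Y)| = |Y| · |ker π|`. [folklore] -/
theorem card_filter_comap (π : G →* DihedralGroup 4) (hπ : Function.Surjective π) (Y : Finset (DihedralGroup 4)) :
    (univ.filter fun g : G => π g ∈ Y).card = Y.card * Nat.card π.ker := by
  classical
  -- decompose the preimage along the values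
  have hdecomp : (univ.filter fun g : G => π g ∈ Y) = Y.biUnion (fun y => univ.filter fun g : G => π g = y) := by
    ext g; simp only [mem_filter, mem_univ, true_and, mem_biUnion, exists_eq_right']
  rw [hdecomp, card_biUnion]
  · have hfib : ∀ y ∈ Y, (univ.filter fun g : G => π g = y).card = Nat.card π.ker := by
      intro y _
      obtain ⟨g₀, hg₀⟩ := hπ y
      have himg : (univ.filter fun g : G => π g = y) = (univ.filter fun g : G => g ∈ π.ker).image (fun k => g₀ * k) := by
        ext g
        simp only [mem_filter, mem_univ, true_and, mem_image, MonoidHom.mem_ker]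
        constructor
        · intro hg
          refine ⟨g₀⁻¹ * g, by rw [map_mul, map_inv, hg₀, hg, inv_mul_cancel], by rw [mul_inv_cancel_left]⟩
        · rintro ⟨k, hk, rfl⟩; rw [map_mul, hg₀, hk, mul_one]
      rw [himg, card_image_of_injective _ (mul_right_injective g₀), Nat.card_eq_fintype_card, ← Fintype.card_subtype]
    rw [Finset.sum_congr rfl hfib, sum_const, smul_eq_mul]
  · intro y _ y' _ hne
    simp only [Function.onFun, disjoint_filter]
    intro g _ hy hy'
    exact hne (hy.symm.trans hy')

/-- **THE DIHEDRAL QUOTIENT LAW.**  `G` a finite `2`-group, `c` a central involution, `π : G →* D₄` surjective with `π c = r²`, `|ker π| ≥ 4`, and an involution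
`q ∈ G` over the reflection `s`: **`μ(G, c) = φ₂(G, c)`**. [folklore] -/
theorem isLeast_card_gfaces_generate_of_dihedral_quotient {c : G} (hG : IsPGroup 2 G) (hc2 : c * c = 1) (hcen : ∀ x : G, x * c = c * x)
    (π : G →* DihedralGroup 4) (hπ : Function.Surjective π) (hπc : π c = r 2) (hker : 4 ≤ Nat.card π.ker)
    (q : G) (hπq : π q = sr 0) (hqq : q * q = 1) :
    IsLeast {n : ℕ | ∃ S : Finset (CMF G c →₀ ℤ), (↑S ⊆ gfaceSet G c hc2) ∧ S.card = n ∧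
      hodgeSpan c hc2 ≤ Submodule.span ℤ (pairSet c) ⊔ Submodule.span ℤ (translates c S)} (fibreTwo c hc2) := by
  classical
  have hc1 : c ≠ 1 := by
    intro h; rw [h, map_one] at hπc; exact absurd hπc (by decide)
  set X₀ : Finset (DihedralGroup 4) := {r 0, r 1, sr 0, sr 1} with hX₀
  let T₀ : CMF G c := ⟨univ.filter fun g : G => π g ∈ X₀, isCMF_comap π hπc⟩
  let T₁ : CMF G c := rt c q T₀
  have hT₀mem : ∀ P : G, P ∈ T₀.1 ↔ π P ∈ X₀ := fun P => by
    change P ∈ univ.filter (fun g : G => π g ∈ X₀) ↔ _; rw [mem_filter]; simp only [mem_univ, true_and]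
  have hrtmem : ∀ (R P : G), P ∈ (rt c R T₀).1 ↔ π P * π R ∈ X₀ := fun R P => by rw [mem_rt, hT₀mem, map_mul]
  have hT₁mem : ∀ P : G, P ∈ T₁.1 ↔ π P * sr 0 ∈ X₀ := fun P => by
    change P ∈ (rt c q T₀).1 ↔ _; rw [hrtmem, hπq]
  -- `𝓗` and `𝓗ᶜ` as pull-backs
  have hHset : T₀.1 \ T₁.1 = univ.filter fun g : G => π g ∈ ({r 1, sr 1} : Finset (DihedralGroup 4)) := by
    ext P; rw [mem_sdiff, hT₀mem, hT₁mem, mem_filter]; simp only [mem_univ, true_and]; exact dihedral_H (π P)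
  have hHcset : T₀.1 ∩ T₁.1 = univ.filter fun g : G => π g ∈ ({r 0, sr 0} : Finset (DihedralGroup 4)) := by
    ext P; rw [mem_inter, hT₀mem, hT₁mem, mem_filter]; simp only [mem_univ, true_and]; exact dihedral_Hc (π P)
  -- the alternatives for the place of `t·q`, pushed to `D₄`
  have hplace : ∀ t t' : G, (t' = t * q ∨ t' = c * (t * q)) → (π t' = π t * sr 0 ∨ π t' = r 2 * (π t * sr 0)) := by
    intro t t' h
    rcases h with h | h
    · left; rw [h, map_mul, hπq]
    · right; rw [h, map_mul, map_mul, hπc, hπq]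
  refine isLeast_card_gfaces_generate_four c hG hc2 hc1 hcen T₀ T₁ ?_ (Nat.card π.ker) (by omega) ?_ ?_ q rfl hqq ?_ ?_ ?_
  · -- the base block
    intro R
    have hrr : ∀ P : G, P ∈ (rt c c T₀).1 ↔ π P * r 2 ∈ X₀ := fun P => by rw [hrtmem, hπc]
    have hrT₁ : ∀ P : G, P ∈ (rt c c T₁).1 ↔ π P * (r 2 * sr 0) ∈ X₀ := fun P => by
      change P ∈ (rt c c (rt c q T₀)).1 ↔ _; rw [← rt_mul, hrtmem, map_mul, hπc, hπq]
    rcases dihedral_base (π R) with h | h | h | h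
    · exact Or.inl (Subtype.ext (Finset.ext fun P => by rw [hrtmem, hT₀mem]; exact h (π P)))
    · exact Or.inr (Or.inl (Subtype.ext (Finset.ext fun P => by rw [hrtmem, hrr]; exact h (π P))))
    · exact Or.inr (Or.inr (Or.inl (Subtype.ext (Finset.ext fun P => by rw [hrtmem, hT₁mem]; exact h (π P)))))
    · exact Or.inr (Or.inr (Or.inr (Subtype.ext (Finset.ext fun P => by rw [hrtmem, hrT₁]; exact h (π P)))))
  · -- `|T₀| = 4m`
    change (univ.filter fun g : G => π g ∈ X₀).card = 4 * Nat.card π.ker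
    rw [card_filter_comap π hπ X₀]; congr 1
  · -- `|𝓗| = 2m`
    rw [hHset, card_filter_comap π hπ]; congr 1
  · -- the swap preserves `𝓗`
    intro t ht t' ht' h
    rw [hT₀mem] at ht ht'
    rw [hHset, mem_filter, mem_filter]; simp only [mem_univ, true_and]
    exact dihedral_sigma_H (π t) (π t') ht ht' (hplace t t' h)
  · -- the transversal `π⁻¹(r) ⊆ 𝓗`
    refine ⟨univ.filter fun g : G => π g ∈ ({r 1} : Finset (DihedralGroup 4)), ?_, ?_, ?_⟩
    · rw [hHset]; intro g hg; rw [mem_filter] at hg ⊢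
      have h := hg.2; rw [mem_singleton] at h
      exact ⟨hg.1, by rw [h]; decide⟩
    · rw [card_filter_comap π hπ, card_singleton, one_mul]
    · intro t ht t' ht' h
      rw [hHset, mem_filter] at ht
      rw [hT₀mem] at ht'
      have htX : π t ∈ X₀ := dihedral_sub.1 (π t) ht.2
      obtain ⟨h2, h3, -, -⟩ := dihedral_sigma_val (π t) (π t') htX ht' (hplace t t' h)
      rw [mem_filter, mem_filter]; simp only [mem_univ, true_and, mem_singleton]
      have ht2 : π t = r 1 ∨ π t = sr 1 := by have h := ht.2; rwa [mem_insert, mem_singleton] at h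
      constructor
      · intro e; rw [h2.mp e]; decide
      · intro hne
        rcases ht2 with e | e
        · exact e
        · exact absurd (h3.mp e) hne
  · -- the transversal `ker π ⊆ T₀ ∩ T₁`
    refine ⟨univ.filter fun g : G => π g ∈ ({r 0} : Finset (DihedralGroup 4)), ?_, ?_, ?_⟩
    · rw [hHcset]; intro g hg; rw [mem_filter] at hg ⊢
      have h := hg.2; rw [mem_singleton] at h
      exact ⟨hg.1, by rw [h]; decide⟩
    · rw [card_filter_comap π hπ, card_singleton, one_mul]
    · intro t ht t' ht' h
      rw [hHcset, mem_filter] at ht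
      rw [hT₀mem] at ht'
      have htX : π t ∈ X₀ := dihedral_sub.2 (π t) ht.2
      obtain ⟨-, -, h4, h5⟩ := dihedral_sigma_val (π t) (π t') htX ht' (hplace t t' h)
      rw [mem_filter, mem_filter]; simp only [mem_univ, true_and, mem_singleton]
      have ht2 : π t = r 0 ∨ π t = sr 0 := by have h := ht.2; rwa [mem_insert, mem_singleton] at h
      constructor
      · intro e; rw [h4.mp e]; decide
      · intro hne
        rcases ht2 with e | e
        · exact e
        · exact absurd (h5.mp e) hne

end

end Summit.HodgeConjecture.CorCM.Census.CentralSquares
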